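import Summits.BirchSwinnertonDyer.BirchSwinnertonDyer.Theses.ManinLocalTwoThree
import Summits.BirchSwinnertonDyer.BirchSwinnertonDyer.Theorems.ManinLocalTwoThreePotGoodComponentWindowThree
import Literature.NumberTheory.EllipticCurves.ManinConstantNonPotentiallyOrdinaryPrimesProofs
import Literature.NumberTheory.EllipticCurves.ManinConstantQuadraticTwistIstarProofs
import Literature.NumberTheory.EllipticCurves.QuadraticTwistTateFormProofs
import Literature.NumberTheory.EllipticCurves.QuadraticTwistTateFormTwoProofs
import Literature.NumberTheory.EllipticCurves.RootNumberTwistSemistableProofs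
import Literature.NumberTheory.EllipticCurves.QuadraticTwistJInvariantProofs
import Literature.NumberTheory.EllipticCurves.SzpiroLocalDataProofs
import Literature.NumberTheory.EllipticCurves.CuspFormLFunctionLevelConductorProofs
import Literature.NumberTheory.DiophantineGeometry.LocalReductionFiniteBadPlacesProofs
import Literature.NumberTheory.DiophantineGeometry.ConductorAdditiveProofs
import Literature.NumberTheory.DiophantineGeometry.LocalReductionProofs
import Literature.NumberTheory.DiophantineGeometry.TateAlgorithmAdditiveProofs
import HarnessLib

/-!
# C3 `ManinPrimeToThreeAtNine` HOLDS on the stratum `ord₃ j ≤ 0` — every potentially multiplicative and every potentially good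
# ORDINARY curve with `9 ∣ N` has Manin constant prime to `3`, GIVEN Mazur 1978 and modularity only (route `ManinLocalTwoThree`,
# crux C3 stmt-BirchSwinnertonDyer-22968; cell bsd-f2-manin, p2 gen 15) — the C3 twin of `…ManinOddAtFourOfOrdJLeZero` / `…OfCore`

LOCAL THEOREM (§2, E-blind, at the place `v ∣ 3` of `ℤ`): an elliptic `W/ℚ` ADDITIVE at `3` with `|j(W)|₃ ≥ 1` (`ord₃ j ≤ 0`) has a
TERNARY TWIST SEMISTABLE AT `3`: `W ⊗ ℚ(√−3)` has good or multiplicative reduction at `3`.  Proof: `W ≅ T^{(d)}` over `ℚ` with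
`T = tateFormOfJ j(W)` and `d ∈ ℤ`, `9 ∤ d` (§1, Silverman *AEC* X.5 Cor. 5.4.1); `T` is `3`-integral with unit discriminant when
`|j|₃ = 1` (`|1728|₃ = 3⁻³ < 1` forces `|j − 1728|₃ = 1`: GOOD reduction) and is the multiplicative Tate form when `|j|₃ > 1`
(`hasMultiplicativeReductionAt_tateFormOfJ_of_one_lt_valuation_j`); a twist by a `3`-adic unit keeps the reduction type
(`hasReductionAt_quadraticTwist_iff_of_not_dvd`, *AEC* VII.5.1), so additivity of `W` forces `3 ∥ d`, `d = 3e`, and then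
`W ⊗ (−3) ≅ T^{(−9e)} ≅ T^{(−e)}` is semistable at `3`.  (Serre–Tate in coordinates: for `ord₃ j ≤ 0` the semistability defect at `3` is
`2`; no Kodaira symbols needed.)
GLOBAL CONSEQUENCE (§3): with the tree's `Γ₀` twist certificate at an odd prime
(`not_dvd_maninConstant_of_isSemistableAt_quadraticTwist_pStar_of_mazur`: Stevens 1989 (5.2) on `Γ₀` + Mazur 1978 Cor. 4.1 at the twisted
class, modularity for its optimal datum) every lattice-optimal `X₀(N)`-datum of a globally minimal `W` with `9 ∣ N` and `ord₃ j(W) ≤ 0` has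
`3 ∤ c` — modulo `hM` (Mazur) and `hnf` (modularity) ONLY, two of the crux's four binders.  Hence C3 is REDUCED BY NAME (§4) to the
potentially SUPERSINGULAR curves at `3` (`|j|₃ < 1`, `maninPrimeToThreeAtNine_of_pos_ordJ`), and further (§4, with the tree's `Iₙ*` rows
`not_dvd_maninConstant_of_kodairaSymbolAt_eq_Istar_of_mazur`) to its CORE: `|j|₃ < 1`, Kodaira type at `3` one of `II, III, IV, IV*, III*, II*`,
and `W ⊗ ℚ(√−3)` again additive at `3` (`maninPrimeToThreeAtNine_of_core`).
HONEST FRAMING: by-name partial discharge + reduction of the crux, modulo its own printed-fact binders; assembled from printed lemmas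
(Silverman *AEC* VII.5.1, X.5.4.1, *ATAEC* V.5.1; Stevens 1989; Mazur 1978), printed nowhere as such (for `p ≥ 11` it is Edixhoven 1991 §1's
remark «the cases I₀, I_ν, I₀*, I_ν* are already proved by Mazur and Stevens»).  Nothing about BSD is proved; Manin's conjecture at `3`
stays OPEN on the core; C3 OPEN.
[cite: SilvermanAEC2009, VII.5 Prop. 5.1 and X.5 Cor. 5.4.1] [cite: SilvermanATAEC1994, V.5 Lemma 5.1] [cite: Stevens1989, Lemmas (5.2), (5.4)]
[cite: Mazur1978, Cor. 4.1] [cite: EdixhovenManin1991, §1]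
-/

set_option autoImplicit false
-- lint-debt: the directory name repeats the summit name (sibling precedent `ManinLocalTwoThreeManinOddAtFourOfOrdJLeZero.lean`)
set_option linter.dupNamespace false

noncomputable section

open scoped Classical
open WeierstrassCurve IsDedekindDomain IsDedekindDomain.HeightOneSpectrum Rat.HeightOneSpectrum
  Literature.NumberTheory.DiophantineGeometry Literature.NumberTheory.EllipticCurves
  Literature.NumberTheory.EllipticCurves.ModularForms

namespace Summit.BirchSwinnertonDyer.BirchSwinnertonDyer.Theorems.ManinLocalTwoThree

/-! ## §1 Normalising the twist parameter of the Tate form: `C • W = T^{(d)}`, `d ∈ ℤ`, `p² ∤ d` -/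

/-- **`C • W = T^{(d)}` with an integer `d` not divisible by `p²`** (`T = tateFormOfJ j(W)`, `j ≠ 0, 1728`, any prime `p`): the
rational twist parameter of Silverman *AEC* X.5 Cor. 5.4.1 may be multiplied by squares, so it can be taken in `ℤ ∖ p²ℤ`.  The sibling
`exists_int_variableChange_eq_quadraticTwist_tateFormOfJ` normalises at `4`; this is the same argument at `p²`.
[cite: SilvermanAEC2009, X.5 Cor. 5.4.1] -/
theorem exists_int_variableChange_eq_quadraticTwist_tateFormOfJ_not_sq_dvd (W : WeierstrassCurve ℚ) [W.IsElliptic]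
    (hj0 : W.j ≠ 0) (hj1728 : W.j ≠ 1728) {p : ℕ} (hp : p.Prime) :
    ∃ d : ℤ, d ≠ 0 ∧ ¬ ((p : ℤ) ^ 2 ∣ d) ∧
      ∃ C : VariableChange ℚ, C • W = (tateFormOfJ W.j).quadraticTwist (d : ℚ) := by
  haveI := isElliptic_tateFormOfJ hj0 hj1728
  obtain ⟨n, hn0, -, C, hC⟩ := W.exists_int_variableChange_eq_quadraticTwist_tateFormOfJ hj0 hj1728
  -- strip the powers of `p²`
  obtain ⟨e, m, hmp, hnm⟩ := Nat.exists_eq_pow_mul_and_not_dvd (Int.natAbs_ne_zero.mpr hn0) (p ^ 2)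
    (Nat.one_lt_pow two_ne_zero hp.one_lt).ne'
  have hm0 : m ≠ 0 := by
    rintro rfl; rw [mul_zero] at hnm; exact (Int.natAbs_ne_zero.mpr hn0) hnm
  -- `d = sign(n) · m`, `n = d · (p^e)²`
  set d : ℤ := n.sign * m with hd
  have hnd : n = d * ((p : ℤ) ^ e) ^ 2 := by
    have h1 : (n.natAbs : ℤ) = ((p ^ 2) ^ e : ℕ) * m := by exact_mod_cast hnm
    have h4 : (((p ^ 2) ^ e : ℕ) : ℤ) = ((p : ℤ) ^ e) ^ 2 := by push_cast; ring
    calc n = n.sign * (n.natAbs : ℤ) := (Int.sign_mul_natAbs n).symm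
      _ = d * ((p : ℤ) ^ e) ^ 2 := by rw [h1, hd, h4]; ring
  have hd0 : d ≠ 0 := by
    rw [hd]
    exact mul_ne_zero (fun h => hn0 (Int.sign_eq_zero_iff_zero.mp h)) (by exact_mod_cast hm0)
  have hdp : ¬ ((p : ℤ) ^ 2 ∣ d) := by
    rw [hd]
    intro h
    apply hmp
    have h' := Int.natAbs_dvd_natAbs.mpr h
    rwa [Int.natAbs_mul, Int.natAbs_sign_of_ne_zero hn0, one_mul, Int.natAbs_natCast, Int.natAbs_pow,
      Int.natAbs_natCast] at h'
  obtain ⟨C₂, hC₂⟩ := (tateFormOfJ W.j).exists_variableChange_quadraticTwist_mul_sq (d : ℚ)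
    ((p : ℚ) ^ e) (pow_ne_zero _ (by exact_mod_cast hp.ne_zero))
  refine ⟨d, hd0, hdp, C₂⁻¹ * C, ?_⟩
  rw [mul_smul, hC, show (n : ℚ) = (d : ℚ) * ((p : ℚ) ^ e) ^ 2 by exact_mod_cast hnd, ← hC₂, inv_smul_smul]

/-! ## §2 At the place above `3`: `ord₃ j ≤ 0` and additive ⟹ the ternary twist `W ⊗ ℚ(√−3)` is semistable at `3` -/

section Place

variable (v : HeightOneSpectrum ℤ)

/-- At a place `v ∣ 3` of `ℤ`: `|j|_v ≥ 1` gives `j ≠ 0`, `j ≠ 1728` and `|j − 1728|_v = |j|_v` (`|1728|₃ = 3⁻³ < 1 ≤ |j|₃`).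
[folklore] -/
theorem j_ne_and_valuation_j_sub_eq_of_one_le_valuation_j_three (hv : natGenerator v = 3)
    (W : WeierstrassCurve ℚ) [W.IsElliptic] (hj : 1 ≤ v.valuation ℚ W.j) :
    W.j ≠ 0 ∧ W.j ≠ 1728 ∧ v.valuation ℚ (W.j - 1728) = v.valuation ℚ W.j := by
  have h1728 : v.valuation ℚ (1728 : ℚ) < 1 := by
    have h := (Literature.NumberTheory.EllipticCurves.Rat.valuation_intCast_lt_one_iff v 1728).mpr
      (by rw [hv]; decide)
    exact_mod_cast h
  have hlt : v.valuation ℚ (1728 : ℚ) < v.valuation ℚ W.j := lt_of_lt_of_le h1728 hj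
  refine ⟨fun h ↦ ?_, fun h ↦ ?_, Valuation.map_sub_eq_of_lt_left _ hlt⟩
  · rw [h, map_zero] at hj; exact not_lt.mpr hj zero_lt_one
  · rw [h] at hlt; exact lt_irrefl _ hlt

/-- **The Tate form `T = tateFormOfJ j(W)` is SEMISTABLE at `3` when `|j|₃ ≥ 1`**: good reduction if `|j|₃ = 1` (`T` is `3`-integral —
coefficients `1, 0, 0, −36/(j−1728), −1/(j−1728)` with `|j − 1728|₃ = 1` — and `Δ(T) = j²/(j−1728)³` is a `3`-adic unit; Silverman
*AEC* VII.5.1(a)), multiplicative if `|j|₃ > 1` (the Tate curve, *ATAEC* V.5 Lemma 5.1; tree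
`hasMultiplicativeReductionAt_tateFormOfJ_of_one_lt_valuation_j`).
[cite: SilvermanAEC2009, VII.5 Prop. 5.1] [cite: SilvermanATAEC1994, V.5 Lemma 5.1] -/
theorem hasGoodReductionAt_or_hasMultiplicativeReductionAt_tateFormOfJ_of_one_le_valuation_j_three
    (hv : natGenerator v = 3) (W : WeierstrassCurve ℚ) [W.IsElliptic] (hj : 1 ≤ v.valuation ℚ W.j) :
    (tateFormOfJ W.j).HasGoodReductionAt v ∨ (tateFormOfJ W.j).HasMultiplicativeReductionAt v := by
  obtain ⟨hj0, hj1728, hsub⟩ := j_ne_and_valuation_j_sub_eq_of_one_le_valuation_j_three v hv W hj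
  haveI := isElliptic_tateFormOfJ hj0 hj1728
  rcases hj.eq_or_lt with hj1 | hjlt
  · -- `|j|₃ = 1`: integral model with unit discriminant
    left
    have hj1' : v.valuation ℚ W.j = 1 := hj1.symm
    have hsub1 : v.valuation ℚ (W.j - 1728) = 1 := by rw [hsub, hj1']
    have h36 : v.valuation ℚ (36 : ℚ) ≤ 1 := by
      simpa using v.valuation_le_one (K := ℚ) (36 : ℤ)
    refine (tateFormOfJ W.j).hasGoodReductionAt_of_valuation_le_one_of_valuation_Δ_eq_one v ?_ ?_ ?_ ?_ ?_ ?_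
    · rw [tateFormOfJ_a₁, map_one]
    · rw [tateFormOfJ_a₂, map_zero]; exact zero_le_one
    · rw [tateFormOfJ_a₃, map_zero]; exact zero_le_one
    · rw [tateFormOfJ_a₄, map_div₀, Valuation.map_neg, hsub1, div_one]; exact h36
    · rw [tateFormOfJ_a₆, map_div₀, Valuation.map_neg, map_one, hsub1, div_one]
    · rw [tateFormOfJ_Δ hj1728, map_div₀, map_pow, map_pow, hsub1, hj1', one_pow, one_pow, div_one]
  · -- `|j|₃ > 1`: the multiplicative Tate form
    exact Or.inr (W.hasMultiplicativeReductionAt_tateFormOfJ_of_one_lt_valuation_j v hjlt)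

/-- **Local theorem (E-blind).**  At the place `v ∣ 3` of `ℤ`: if the elliptic `W/ℚ` is ADDITIVE at `v` and `|j(W)|₃ ≥ 1` (`ord₃ j ≤ 0`:
potentially multiplicative, or potentially good with ORDINARY — `j ≢ 0 (mod 3)` — reduction), then its ternary twist `W ⊗ ℚ(√−3)` is
SEMISTABLE at `v` (good or multiplicative reduction).  Proof: `C • W = T^{(d)}`, `T = tateFormOfJ j`, `d ∈ ℤ`, `9 ∤ d` (§1); `T` is
semistable at `3`; a twist by a `3`-adic unit keeps the reduction type (`hasReductionAt_quadraticTwist_iff_of_not_dvd`), so `3 ∣ d`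
(else `W` would be semistable), `d = 3e` with `3 ∤ e`, and `W ⊗ (−3) ≅ T^{(−9e)} ≅ T^{(−e)}` has the type of `T`.
[cite: SilvermanAEC2009, VII.5 Prop. 5.1 and X.5 Cor. 5.4.1] [cite: SilvermanATAEC1994, V.5 Lemma 5.1] -/
theorem isSemistableAt_quadraticTwist_negThree_of_one_le_valuation_j_of_hasAdditiveReductionAt
    (hv : natGenerator v = 3) (W : WeierstrassCurve ℚ) [W.IsElliptic] (hj : 1 ≤ v.valuation ℚ W.j)
    (hadd : W.HasAdditiveReductionAt v) :
    (haveI := W.isElliptic_quadraticTwist (show ((-3 : ℤ) : ℚ) ≠ 0 by norm_num);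
      (W.quadraticTwist ((-3 : ℤ) : ℚ)).HasGoodReductionAt v ∨
        (W.quadraticTwist ((-3 : ℤ) : ℚ)).HasMultiplicativeReductionAt v) := by
  haveI := W.isElliptic_quadraticTwist (show ((-3 : ℤ) : ℚ) ≠ 0 by norm_num)
  obtain ⟨hj0, hj1728, -⟩ := j_ne_and_valuation_j_sub_eq_of_one_le_valuation_j_three v hv W hj
  haveI := isElliptic_tateFormOfJ hj0 hj1728
  set T := tateFormOfJ W.j with hT
  have hv2 : natGenerator v ≠ 2 := by rw [hv]; decide
  have hTsemi := hasGoodReductionAt_or_hasMultiplicativeReductionAt_tateFormOfJ_of_one_le_valuation_j_three v hv W hj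
  obtain ⟨d, hd0, hd9, C, hC⟩ :=
    exists_int_variableChange_eq_quadraticTwist_tateFormOfJ_not_sq_dvd W hj0 hj1728 Nat.prime_three
  have hd0' : ((d : ℤ) : ℚ) ≠ 0 := by exact_mod_cast hd0
  haveI := T.isElliptic_quadraticTwist hd0'
  -- `3 ∣ d`: otherwise `T^{(d)} ≅ W` would be semistable at `3`
  have h3d : (3 : ℤ) ∣ d := by
    by_contra h
    have hCW : (T.quadraticTwist (d : ℚ)).HasAdditiveReductionAt v := by
      rw [← hC]; exact (hasAdditiveReductionAt_smul_iff_holds v W C).mpr hadd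
    have hTadd : T.HasAdditiveReductionAt v :=
      (T.hasReductionAt_quadraticTwist_iff_of_not_dvd v hv2 (d := d) (by rwa [hv])).2.2.mp hCW
    rcases hTsemi with hg | hm
    · exact hTadd.not_hasGoodReductionAt hg
    · exact hTadd.not_hasMultiplicativeReductionAt hm
  obtain ⟨e, he⟩ := h3d
  have he0 : e ≠ 0 := by rintro rfl; exact hd0 (by rw [he, mul_zero])
  have h3e : ¬ ((natGenerator v : ℕ) : ℤ) ∣ -e := by
    rw [hv, Int.dvd_neg]
    rintro ⟨f, hf⟩
    exact hd9 ⟨f, by rw [he, hf]; ring⟩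
  have he0' : ((-e : ℤ) : ℚ) ≠ 0 := by exact_mod_cast (neg_ne_zero.mpr he0)
  haveI := T.isElliptic_quadraticTwist he0'
  -- `C₁ • (W ⊗ (−3)) = (C • W) ⊗ (−3) = T^{(d·(−3))} = T^{((−e)·3²)} = C₂ • T^{(−e)}`
  set C₁ : VariableChange ℚ := ⟨C.u, ((-3 : ℤ) : ℚ) * C.r, 0, 0⟩ with hC₁
  obtain ⟨C₂, hC₂⟩ := T.exists_variableChange_quadraticTwist_mul_sq ((-e : ℤ) : ℚ) (3 : ℚ) three_ne_zero
  have harg : ((3 * e : ℤ) : ℚ) * ((-3 : ℤ) : ℚ) = ((-e : ℤ) : ℚ) * (3 : ℚ) ^ 2 := by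
    have h : (3 * e) * (-3 : ℤ) = (-e) * 3 ^ 2 := by ring
    exact_mod_cast h
  have hkey : C₁ • W.quadraticTwist ((-3 : ℤ) : ℚ) = C₂ • T.quadraticTwist ((-e : ℤ) : ℚ) := by
    rw [hC₁, ← quadraticTwist_smul, hC, quadraticTwist_quadraticTwist, hC₂, he, harg]
  have hunit := T.hasReductionAt_quadraticTwist_iff_of_not_dvd v hv2 (d := -e) h3e
  rcases hTsemi with hg | hm
  · left
    have h1 : (C₂ • T.quadraticTwist ((-e : ℤ) : ℚ)).HasGoodReductionAt v :=
      (hasGoodReductionAt_smul_iff_holds v _ C₂).mpr (hunit.1.mpr hg)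
    rw [← hkey] at h1
    exact (hasGoodReductionAt_smul_iff_holds v _ C₁).mp h1
  · right
    have h1 : (C₂ • T.quadraticTwist ((-e : ℤ) : ℚ)).HasMultiplicativeReductionAt v :=
      (hasMultiplicativeReductionAt_smul_iff_holds v _ C₂).mpr (hunit.2.1.mpr hm)
    rw [← hkey] at h1
    exact (hasMultiplicativeReductionAt_smul_iff_holds v _ C₁).mp h1

end Place

/-! ## §3 C3 on the stratum `ord₃ j ≤ 0`, modulo Mazur 1978 and modularity only -/

/-- **`ManinPrimeToThreeAtNine` on `ord₃ j ≤ 0`, from Mazur's Cor. 4.1 (`hM`) and modularity (`hnf`) alone.**  For every lattice-optimal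
`X₀(N)`-datum `D` of a globally minimal `W/ℚ` with `9 ∣ N` and `|j(W)|₃ ≥ 1` (potentially multiplicative, or potentially good ordinary,
at `3`): `3 ∤ D.maninConstant`.  Proof: `9 ∣ N = N(W)` makes `W` additive at `3`; by §2 the twist `W ⊗ χ₋₃` is semistable at `3`; the tree's
`Γ₀` twist certificate `not_dvd_maninConstant_of_isSemistableAt_quadraticTwist_pStar_of_mazur` (Stevens 1989 (5.2) on `Γ₀`, Mazur 1978 at the
twisted class, an optimal datum there from modularity) concludes.
[cite: Stevens1989, Lemmas (5.2), (5.4)] [cite: Mazur1978, Cor. 4.1] [cite: SilvermanAEC2009, X.5 Cor. 5.4.1] -/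
theorem not_three_dvd_maninConstant_of_one_le_valuation_j_of_mazur
    (hM : mazur_not_dvd_maninConstant_of_odd) (hnf : exists_isNewformOf)
    {W : WeierstrassCurve ℚ} [W.IsElliptic] [W.IsGloballyMinimal] {N : ℕ} [NeZero N] (D : ModularParametrizationData W N)
    (hopt : ∀ z ∈ D.L.lattice, ∃ w ∈ periodLattice D.f, z = D.c * w) (h9 : 3 ^ 2 ∣ N)
    (hj : 1 ≤ ((primesEquiv (R := ℤ)).symm ⟨3, Nat.prime_three⟩).valuation ℚ W.j) :
    ¬ (3 : ℤ) ∣ D.maninConstant := by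
  set v : HeightOneSpectrum ℤ := (primesEquiv (R := ℤ)).symm ⟨3, Nat.prime_three⟩ with hvdef
  have hv : natGenerator v = 3 := congrArg Subtype.val ((primesEquiv (R := ℤ)).apply_symm_apply ⟨3, Nat.prime_three⟩)
  -- `W` is additive at `3`
  have hN : N = W.conductorNorm ℤ := IsNewformOf.level_eq_conductorNorm_of_exists_isNewformOf hnf D.isNewformOf
  have hadd : W.HasAdditiveReductionAt v := by
    refine (two_le_conductorExponent_iff_holds v W).mp ?_
    rw [hvdef, ← factorization_conductorNorm_primesEquiv_symm W ⟨3, Nat.prime_three⟩]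
    exact (Nat.prime_three.pow_dvd_iff_le_factorization (W.conductorNorm_pos_holds).ne').mp (hN ▸ h9)
  have hsemi := isSemistableAt_quadraticTwist_negThree_of_one_le_valuation_j_of_hasAdditiveReductionAt v hv W hj hadd
  refine not_dvd_maninConstant_of_isSemistableAt_quadraticTwist_pStar_of_mazur hM hnf D hopt Nat.prime_three (by decide) h9 ?_
  convert hsemi using 3 <;> norm_num

/-- **`ManinPrimeToThreeAtNine` on `ord₃ j ≤ 0`, crux shape** (all four printed-fact binders offered; only Mazur and modularity used).
[cite: Stevens1989, Lemmas (5.2), (5.4)] [cite: Mazur1978, Cor. 4.1] -/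
theorem maninPrimeToThreeAtNine_of_one_le_valuation_j :
    mazur_not_dvd_maninConstant_of_odd → abbesUllmo_not_dvd_maninConstant_of_not_dvd_level →
      cesnavicius_not_two_dvd_maninConstant_of_two_dvd_level → exists_isNewformOf →
      ∀ (W : WeierstrassCurve ℚ) [W.IsElliptic] [W.IsGloballyMinimal] {N : ℕ} [NeZero N] (D : ModularParametrizationData W N),
        (∀ z ∈ D.L.lattice, ∃ w ∈ periodLattice D.f, z = D.c * w) → 3 ^ 2 ∣ N →
        1 ≤ ((primesEquiv (R := ℤ)).symm ⟨3, Nat.prime_three⟩).valuation ℚ W.j → ¬ (3 : ℤ) ∣ D.maninConstant :=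
  fun hM _ _ hnf _ _ _ _ _ D hopt h9 hj ↦ not_three_dvd_maninConstant_of_one_le_valuation_j_of_mazur hM hnf D hopt h9 hj

/-! ## §4 C3 BY NAME from its restriction to the potentially supersingular curves, and to its core -/

/-- **C3 reduced by name to `ord₃ j > 0`.**  If, granted the four printed facts, every lattice-optimal `X₀(N)`-datum (`9 ∣ N`) of every
globally minimal `W` with `|j(W)|₃ < 1` (potentially SUPERSINGULAR at `3`) has Manin constant prime to `3`, then the route decl
`ManinPrimeToThreeAtNine` holds: the complement `|j|₃ ≥ 1` is §3.
[cite: Stevens1989, Lemmas (5.2), (5.4)] [cite: Mazur1978, Cor. 4.1] -/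
theorem maninPrimeToThreeAtNine_of_pos_ordJ
    (hcore : mazur_not_dvd_maninConstant_of_odd → abbesUllmo_not_dvd_maninConstant_of_not_dvd_level →
      cesnavicius_not_two_dvd_maninConstant_of_two_dvd_level → exists_isNewformOf →
      ∀ (W : WeierstrassCurve ℚ) [W.IsElliptic] [W.IsGloballyMinimal] {N : ℕ} [NeZero N] (D : ModularParametrizationData W N),
        (∀ z ∈ D.L.lattice, ∃ w ∈ periodLattice D.f, z = D.c * w) → 3 ^ 2 ∣ N →
        ((primesEquiv (R := ℤ)).symm ⟨3, Nat.prime_three⟩).valuation ℚ W.j < 1 →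
        ¬ (3 : ℤ) ∣ D.maninConstant) :
    Summit.BirchSwinnertonDyer.BirchSwinnertonDyer.Theses.ManinLocalTwoThree.ManinPrimeToThreeAtNine := by
  intro hM hAU hC2 hnf W _ _ N _ D hopt h9
  by_cases hj : ((primesEquiv (R := ℤ)).symm ⟨3, Nat.prime_three⟩).valuation ℚ W.j < 1
  · exact hcore hM hAU hC2 hnf W D hopt h9 hj
  · exact not_three_dvd_maninConstant_of_one_le_valuation_j_of_mazur hM hnf D hopt h9 (not_lt.mp hj)

/-- **C3 from its core.**  If, granted the four printed facts, every lattice-optimal `X₀(N)`-datum (`9 ∣ N`) of every globally minimal `W`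
that is potentially SUPERSINGULAR at `3` (`|j|₃ < 1`), whose Kodaira type at `3` is one of `II, III, IV, IV*, III*, II*` (not `Iₙ*`), and whose
ternary twist `W ⊗ ℚ(√−3)` is again ADDITIVE at `3`, has Manin constant prime to `3`, then `ManinPrimeToThreeAtNine` holds: the complement
is covered by §3 (`|j|₃ ≥ 1`), by the tree's `Iₙ*` rows `not_dvd_maninConstant_of_kodairaSymbolAt_eq_Istar_of_mazur` (Stevens on `Γ₀` +
Mazur), and by the semistable-twist certificate `not_dvd_maninConstant_of_isSemistableAt_quadraticTwist_pStar_of_mazur`; the positive type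
list is Tate's algorithm (`isAdditive_kodairaSymbolAt_iff_holds`, the seven additive symbols).  The three core binders are offered
together (each alone already places the class outside every landed discharge).
[cite: Stevens1989, Lemmas (5.2), (5.4)] [cite: Mazur1978, Cor. 4.1] [cite: EdixhovenManin1991, §1] [cite: SilvermanATAEC1994, IV.9.4 Table 4.1] -/
theorem maninPrimeToThreeAtNine_of_core
    (hcore : mazur_not_dvd_maninConstant_of_odd → abbesUllmo_not_dvd_maninConstant_of_not_dvd_level →
      cesnavicius_not_two_dvd_maninConstant_of_two_dvd_level → exists_isNewformOf →
      ∀ (W : WeierstrassCurve ℚ) [W.IsElliptic] [W.IsGloballyMinimal] {N : ℕ} [NeZero N] (D : ModularParametrizationData W N),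
        (∀ z ∈ D.L.lattice, ∃ w ∈ periodLattice D.f, z = D.c * w) → 3 ^ 2 ∣ N →
        ((primesEquiv (R := ℤ)).symm ⟨3, Nat.prime_three⟩).valuation ℚ W.j < 1 →
        (W.kodairaSymbolAt ((primesEquiv (R := ℤ)).symm ⟨3, Nat.prime_three⟩) = .II ∨
          W.kodairaSymbolAt ((primesEquiv (R := ℤ)).symm ⟨3, Nat.prime_three⟩) = .III ∨
          W.kodairaSymbolAt ((primesEquiv (R := ℤ)).symm ⟨3, Nat.prime_three⟩) = .IV ∨
          W.kodairaSymbolAt ((primesEquiv (R := ℤ)).symm ⟨3, Nat.prime_three⟩) = .IVstar ∨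
          W.kodairaSymbolAt ((primesEquiv (R := ℤ)).symm ⟨3, Nat.prime_three⟩) = .IIIstar ∨
          W.kodairaSymbolAt ((primesEquiv (R := ℤ)).symm ⟨3, Nat.prime_three⟩) = .IIstar) →
        (haveI := W.isElliptic_quadraticTwist (show ((-3 : ℤ) : ℚ) ≠ 0 by norm_num);
          (W.quadraticTwist ((-3 : ℤ) : ℚ)).HasAdditiveReductionAt ((primesEquiv (R := ℤ)).symm ⟨3, Nat.prime_three⟩)) →
        ¬ (3 : ℤ) ∣ D.maninConstant) :
    Summit.BirchSwinnertonDyer.BirchSwinnertonDyer.Theses.ManinLocalTwoThree.ManinPrimeToThreeAtNine := by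
  refine maninPrimeToThreeAtNine_of_pos_ordJ fun hM hAU hC2 hnf W _ _ N _ D hopt h9 hj ↦ ?_
  set v : HeightOneSpectrum ℤ := (primesEquiv (R := ℤ)).symm ⟨3, Nat.prime_three⟩ with hvdef
  have hv : natGenerator v = 3 := congrArg Subtype.val ((primesEquiv (R := ℤ)).apply_symm_apply ⟨3, Nat.prime_three⟩)
  haveI := W.isElliptic_quadraticTwist (show ((-3 : ℤ) : ℚ) ≠ 0 by norm_num)
  -- the `Iₙ*` rows
  by_cases hI : ∃ n : ℕ, W.kodairaSymbolAt v = .Istar n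
  · obtain ⟨n, hn⟩ := hI
    exact not_dvd_maninConstant_of_kodairaSymbolAt_eq_Istar_of_mazur hM hnf D hopt Nat.prime_three (by decide) hn
  -- a semistable ternary twist
  by_cases htw : (W.quadraticTwist ((-3 : ℤ) : ℚ)).HasAdditiveReductionAt v
  swap
  · have hsemi : (W.quadraticTwist ((-3 : ℤ) : ℚ)).HasGoodReductionAt v ∨
        (W.quadraticTwist ((-3 : ℤ) : ℚ)).HasMultiplicativeReductionAt v := by
      rcases hasGoodReductionAt_or_hasMultiplicativeReductionAt_or_hasAdditiveReductionAt v (W.quadraticTwist ((-3 : ℤ) : ℚ)) with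
        hg | hm | ha
      · exact Or.inl hg
      · exact Or.inr hm
      · exact absurd ha htw
    refine not_dvd_maninConstant_of_isSemistableAt_quadraticTwist_pStar_of_mazur hM hnf D hopt Nat.prime_three (by decide) h9 ?_
    convert hsemi using 3 <;> norm_num
  -- the core: additive type, not `Iₙ*`
  have hN : N = W.conductorNorm ℤ := IsNewformOf.level_eq_conductorNorm_of_exists_isNewformOf hnf D.isNewformOf
  have hadd : W.HasAdditiveReductionAt v := by
    refine (two_le_conductorExponent_iff_holds v W).mp ?_
    rw [hvdef, ← factorization_conductorNorm_primesEquiv_symm W ⟨3, Nat.prime_three⟩]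
    exact (Nat.prime_three.pow_dvd_iff_le_factorization (W.conductorNorm_pos_holds).ne').mp (hN ▸ h9)
  have hK : (W.kodairaSymbolAt v).IsAdditive := (isAdditive_kodairaSymbolAt_iff_holds v W).mpr hadd
  refine hcore hM hAU hC2 hnf W D hopt h9 hj ?_ htw
  rcases eq_of_isAdditive hK with h | h | h | ⟨n, h⟩ | h | h | h
  · exact Or.inl h
  · exact Or.inr (Or.inl h)
  · exact Or.inr (Or.inr (Or.inl h))
  · exact absurd ⟨n, h⟩ hI
  · exact Or.inr (Or.inr (Or.inr (Or.inl h)))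
  · exact Or.inr (Or.inr (Or.inr (Or.inr (Or.inl h))))
  · exact Or.inr (Or.inr (Or.inr (Or.inr (Or.inr h))))

end Summit.BirchSwinnertonDyer.BirchSwinnertonDyer.Theorems.ManinLocalTwoThree

end
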